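import Summits.RiemannHypothesis.RiemannHypothesis.Theses.ScrewLemmaKExtremalRay
import HarnessLib

/-!
# Route ScrewLemmaKExtremalRay (L24 «EXTREMAL RAY») — support item `ThresholdRoom` (stmt-RiemannHypothesis-22263)

By-name closer (rh-split typer-4 g0). The block between the markers is rh-idea-5's desk file
`ThresholdRoom22263.lean` (sha16 ceee0eeb61f4f8a2, pub/ideators/rh-idea-5/) VERBATIM except: (i) its
`import Mathlib` line is dropped (the route-file import re-exports Mathlib), (ii) ONE docstring line is inserted
above `theorem thresholdRoom` (gate `lint.docstring`; RULING #224 (b) class). Then the one-line closer typed by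
the ROUTE DECL. RH-free, pure arithmetic; nothing here bears on the truth of RH.
-/

-- D-0017: `Summit.RiemannHypothesis.RiemannHypothesis.…` duplicates the namespace BY DESIGN (single-problem summit).
set_option linter.dupNamespace false

-- ===== BEGIN rh-idea-5 ThresholdRoom22263.lean (ceee0eeb61f4f8a2), minus `import Mathlib`, plus one docstring =====

/-!
# Closer bytes for support item stmt-RiemannHypothesis-22263 `ThresholdRoom` (route ScrewLemmaKExtremalRay, rh-idea-5 g0)

Verbatim item signature:
`∀ K : ℝ, Real.pi ^ 2 - 1 < K → ∃ ε : ℝ, 0 < ε ∧ ε < 1 / 36 ∧ Real.pi ^ 2 * (1 / 6 + ε) ^ 2 < 36 * (K + 1) * (1 / 36 - ε) ^ 2`.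
Pure arithmetic (ε := min (1/100) ((K + 1 − π²)/(100 (K + 11)))).  Landing: `theorem thresholdRoom_holds :
Summit.RiemannHypothesis.RiemannHypothesis.Theses.ScrewLemmaKExtremalRay.ThresholdRoom := thresholdRoom` once the Theses olean exists.
RH-free; nothing here bears on the truth of RH.
-/

namespace Summit.RiemannHypothesis.RiemannHypothesis.Theorems.IntegerScrew.ThresholdRoomSketch

/-- `ThresholdRoom`, verbatim item signature (rh-idea-5 g0): explicit `ε`, `nlinarith`. RH-free. -/
theorem thresholdRoom :
    ∀ K : ℝ, Real.pi ^ 2 - 1 < K → ∃ ε : ℝ, 0 < ε ∧ ε < 1 / 36 ∧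
      Real.pi ^ 2 * (1 / 6 + ε) ^ 2 < 36 * (K + 1) * (1 / 36 - ε) ^ 2 := by
  intro K hK
  have hpi0 : 0 < Real.pi ^ 2 := by positivity
  have hK1 : 0 < K + 1 - Real.pi ^ 2 := by linarith
  have hKp : 0 < 100 * (K + 11) := by nlinarith
  refine ⟨min (1 / 100) ((K + 1 - Real.pi ^ 2) / (100 * (K + 11))), ?_, ?_, ?_⟩
  · exact lt_min (by norm_num) (div_pos hK1 hKp)
  · exact lt_of_le_of_lt (min_le_left _ _) (by norm_num)
  · set e := min (1 / 100) ((K + 1 - Real.pi ^ 2) / (100 * (K + 11))) with he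
    have he1 : e ≤ 1 / 100 := min_le_left _ _
    have he2 : e ≤ (K + 1 - Real.pi ^ 2) / (100 * (K + 11)) := min_le_right _ _
    have he3 : e * (100 * (K + 11)) ≤ K + 1 - Real.pi ^ 2 := (le_div_iff₀ hKp).mp he2
    have he0 : 0 < e := lt_min (by norm_num) (div_pos hK1 hKp)
    nlinarith [sq_nonneg e, mul_pos he0 hK1]

end Summit.RiemannHypothesis.RiemannHypothesis.Theorems.IntegerScrew.ThresholdRoomSketch
-- ===== END rh-idea-5 ThresholdRoom22263.lean =====

namespace Summit.RiemannHypothesis.RiemannHypothesis.Theorems.ScrewLemmaKExtremalRay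

/-- **Support item `ThresholdRoom` (stmt-RiemannHypothesis-22263) holds**: for every `K > π² − 1` there is
`ε ∈ (0, 1/36)` with `π²(1/6+ε)² < 36(K+1)(1/36−ε)²` (explicit `ε := min (1/100) ((K+1−π²)/(100(K+11)))`).
By name from `IntegerScrew.ThresholdRoomSketch.thresholdRoom` above. RH-free. -/
theorem thresholdRoom_proof :
    Summit.RiemannHypothesis.RiemannHypothesis.Theses.ScrewLemmaKExtremalRay.ThresholdRoom :=
  IntegerScrew.ThresholdRoomSketch.thresholdRoom

end Summit.RiemannHypothesis.RiemannHypothesis.Theorems.ScrewLemmaKExtremalRay
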